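import Summits.CriticalPhenomena.CardyFormulaZ2.Theorems.CardyUSTContinuationUniformAnalyticExtensionStubZeroFreeJoint
import Summits.CriticalPhenomena.CardyFormulaZ2.Theorems.CardyUSTContinuationUniformAnalyticExtensionStubZeroFreeNonCrossing
import Literature.Probability.LatticeModels.FKTwoArcPartitionPolynomials
import Literature.Probability.Percolation.BoxCrossingProofs
import HarnessLib

/-!
# Parity and tightness at `t = −1` for the event-restricted two-arc polynomials
# (stub `stub_zeroFreeNonCrossing`, line `registered`, skeleton v6 of the crux
# `UniformAnalyticExtension`, stmt-CriticalPhenomena-6047, route `CardyUSTContinuation`)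

The stub asks for a `δ`-UNIFORM complex zero-free neighbourhood of `[t₁, 1]` for the non-crossing
polynomial `N^c_δ = Z_δ − N_δ` of a discretised conformal rectangle (`N_δ(z) ≠ Z_δ(z)`,
`N_δ = fkTwoArcCrossingPolynomial R δ .joint`, `Z_δ = fkTwoArcPartitionPolynomials R δ .joint`); its
sibling `stub_zeroFreeCrossing` asks the same for `N_δ`.  The `δ`-uniformity is a volume-uniform
Lee–Yang statement AT criticality and is not proved here (nor in print); the per-mesh content is in
`…StubZeroFreeNonCrossing.lean`.  This file proves the PARITY / TIGHTNESS package for the two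
event-restricted polynomials, the analogue of `zeroFreeJoint_rho_le` (`Z_δ(−1) = 0`, whence every
witness `ρ` of `stub_zeroFreeJoint` has `ρ ≤ 1 + t₁`):

* `zeroFreeNonCrossing_aeval_neg_one_rcArcPolynomialIn` (P1): for every finite graph, event `U` and
  edge `e` whose toggling preserves `U`, `N^w_{G,U}(−1) = Σ_{ω ∈ U} (−1)^{|ω|+2k} = 0`;
* `zeroFreeNonCrossing_sdiff_mem_arcCrossing`, `zeroFreeNonCrossing_insert_mem_arcCrossing_iff`
  (P3): toggling an edge with both endpoints in ONE wired arc preserves the crossing event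
  `{B₁ ↔ B₂}`;
* `zeroFreeNonCrossing_aeval_neg_one_crossing_of_adj`,
  `zeroFreeNonCrossing_aeval_neg_one_eq_of_adj` (P4): for `δ > 0`, an edge of `Ω_δ` inside a
  discrete arc forces `N_δ(−1) = 0 = Z_δ(−1)`, so `N^c_δ(−1) = 0`;
  `zeroFreeNonCrossing_crossing_rho_le_of_frequently_adj`,
  `zeroFreeNonCrossing_rho_le_of_frequently_adj`: if such edges exist for arbitrarily small `δ`,
  every witness `ρ` of either sibling stub at `(R, t₁)`, `0 < t₁ ≤ 1`, has `ρ ≤ 1 + t₁`;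
* (P2) the geometric input (an edge of `Ω_δ` inside a discrete arc) is NOT automatic: for the
  diamond `{|x| + |y| < 1}` with its corners marked, at every mesh the discrete boundary
  `{|i| + |j| = m}` spans no edge of `Ω_δ`, and by enumeration `N(−1) = 1, 7 ≠ 0` for the diamonds
  `|i| + |j| ≤ 1, 2` with two opposite sides as arcs — `N_δ(−1) = 0` is not a general fact, so the
  edge is kept as a hypothesis here; the companion file `…StubZeroFreeNonCrossingParityRect.lean`
  supplies it for all small `δ` for axis-parallel rectangles (`Percolation.rectQuad`), making (P4)
  unconditional there;
* `zeroFreeNonCrossing_pencil`, `zeroFreeNonCrossing_ne_iff_of_sq_ne_one`,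
  `zeroFreeNonCrossing_eventually_pencil` (P5): the exact identities
  `(z² − 1)·N_δ(z) = z²·Z^joint_δ(z) − Z^sep_δ(z)`, `(z² − 1)·N^c_δ(z) = Z^sep_δ(z) − Z^joint_δ(z)`
  (from `fkTwoArcPartitionPolynomials_separate_add`), so that for `z² ≠ 1` the two sibling stubs are
  the zero-freeness of the two canonical members `Z^sep − Z^joint`, `z²·Z^joint − Z^sep` of the
  pencil spanned by the partition functions of the two WIRINGS.
-/

noncomputable section

open Filter Topology Set Polynomial Metric
open Literature.Probability.LatticeModels
open Literature.Probability.RandomPlanarGeometry (ConformalRectangle)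

namespace Summit.CriticalPhenomena.CardyFormulaZ2.Cruxes.UniformAnalyticExtension.Birth

/-! ### (P1) The parity involution for an event-restricted polynomial -/

/-- **Parity involution with an event: `N^w_{G,U}(−1) = 0`.** For a finite graph `G`, wired sets
`B₁, B₂`, a wiring `w`, an event `U` and an edge `e` of `G` whose toggling preserves `U` on
configurations of edges of `G`, the restricted self-dual polynomial vanishes at `t = −1`:
`Σ_{ω ⊆ E(G), ω ∈ U} (−1)^{|ω| + 2k^w(ω)} = Σ_{ω ⊆ E(G), ω ∈ U} (−1)^{|ω|} = 0` (the involution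
`ω ↦ ω Δ {e}` preserves the summation range and flips the sign; the cluster count only enters
through the even exponent `2k^w(ω)`). [folklore] -/
theorem zeroFreeNonCrossing_aeval_neg_one_rcArcPolynomialIn {V : Type*} [Fintype V] [DecidableEq V]
    (G : SimpleGraph V) [DecidableRel G.Adj]
    (U : Set (Literature.Probability.Percolation.BondConfig V)) (B₁ B₂ : Set V) (w : ArcWiring)
    {e : Sym2 V} (he : e ∈ G.edgeFinset)
    (hU : ∀ ω : Finset (Sym2 V), ω ⊆ G.edgeFinset → e ∉ ω →
      ((↑(insert e ω) : Literature.Probability.Percolation.BondConfig V) ∈ U ↔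
        (↑ω : Literature.Probability.Percolation.BondConfig V) ∈ U)) :
    aeval (-1 : ℂ) (rcArcPolynomialIn G U B₁ B₂ w) = 0 := by
  classical
  rw [aeval_rcArcPolynomialIn]
  have h : ∀ ω ∈ G.edgeFinset.powerset.filter
      (fun ω : Finset (Sym2 V) => (↑ω : Literature.Probability.Percolation.BondConfig V) ∈ U),
      (-1 : ℂ) ^ (Finset.card ω +
          2 * arcClusterCount (↑ω : Literature.Probability.Percolation.BondConfig V) B₁ B₂ w) =
        (-1 : ℂ) ^ Finset.card ω := by
    intro ω _
    rw [pow_add, pow_mul, neg_one_sq, one_pow, mul_one]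
  rw [Finset.sum_congr rfl h]
  refine Finset.sum_involution (fun ω _ => if e ∈ ω then ω.erase e else insert e ω) ?_ ?_ ?_ ?_
  · intro ω _
    by_cases heω : e ∈ ω
    · rw [if_pos heω, ← Finset.card_erase_add_one heω, pow_succ]; ring
    · rw [if_neg heω, Finset.card_insert_of_notMem heω, pow_succ]; ring
  · intro ω _ _
    by_cases heω : e ∈ ω
    · rw [if_pos heω]; exact fun h => (Finset.notMem_erase e ω) (h.symm ▸ heω)
    · rw [if_neg heω]; exact fun h => heω (h ▸ Finset.mem_insert_self e ω)
  · intro ω hω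
    obtain ⟨hωE, hωU⟩ := Finset.mem_filter.1 hω
    rw [Finset.mem_powerset] at hωE
    refine Finset.mem_filter.2 ?_
    by_cases heω : e ∈ ω
    · rw [if_pos heω]
      refine ⟨Finset.mem_powerset.2 ((Finset.erase_subset e ω).trans hωE), ?_⟩
      have := hU (ω.erase e) ((Finset.erase_subset e ω).trans hωE) (Finset.notMem_erase e ω)
      rw [Finset.insert_erase heω] at this
      exact this.1 hωU
    · rw [if_neg heω]
      exact ⟨Finset.mem_powerset.2 (Finset.insert_subset he hωE), (hU ω hωE heω).2 hωU⟩
  · intro ω _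
    by_cases heω : e ∈ ω
    · simp only [if_pos heω, Finset.notMem_erase, if_false, Finset.insert_erase heω]
    · simp only [if_neg heω, Finset.mem_insert_self, if_true, Finset.erase_insert heω]

/-! ### (P3) Toggling an edge inside a wired arc preserves the crossing event -/

/-- The crossing event is symmetric in the two arcs. [folklore] -/
theorem zeroFreeNonCrossing_mem_arcCrossing_comm {V : Type*} {B₁ B₂ : Set V}
    {ω : Literature.Probability.Percolation.BondConfig V} :
    ω ∈ arcCrossing B₁ B₂ ↔ ω ∈ arcCrossing B₂ B₁ := by
  constructor
  · rintro ⟨x, hx, y, hy, hxy⟩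
    exact ⟨y, hy, x, hx, hxy.symm⟩
  · rintro ⟨x, hx, y, hy, hxy⟩
    exact ⟨y, hy, x, hx, hxy.symm⟩

/-- **Closing an edge inside the first arc keeps the crossing.** If `u, v ∈ B₁` and `ω` has an
open path from `B₁` to `B₂`, so does `ω ∖ {uv}`: follow the path from its last visit to `{u, v}`
(a vertex of `B₁`). [folklore] -/
theorem zeroFreeNonCrossing_sdiff_mem_arcCrossing {V : Type*} {B₁ B₂ : Set V}
    {ω : Literature.Probability.Percolation.BondConfig V} {u v : V} (hu : u ∈ B₁) (hv : v ∈ B₁)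
    (h : ω ∈ arcCrossing B₁ B₂) : ω \ {s(u, v)} ∈ arcCrossing B₁ B₂ := by
  obtain ⟨x, hx, y, hy, ⟨p⟩⟩ := h
  suffices H : ∀ {a b : V} (_ : (Literature.Probability.Percolation.openGraph ω).Walk a b),
      b ∈ B₂ →
        (∃ x ∈ B₁, (Literature.Probability.Percolation.openGraph (ω \ {s(u, v)})).Reachable x a) →
          ω \ {s(u, v)} ∈ arcCrossing B₁ B₂ from
    H p hy ⟨x, hx, SimpleGraph.Reachable.refl _⟩
  intro a b p
  induction p with
  | nil =>
    rintro hb ⟨x, hx, hxa⟩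
    exact ⟨x, hx, _, hb, hxa⟩
  | @cons a c _ hadj _ ih =>
    rintro hb ⟨x, hx, hxa⟩
    by_cases hc : s(a, c) = s(u, v)
    · have hcB : c ∈ B₁ := by
        rcases Sym2.eq_iff.1 hc with ⟨-, rfl⟩ | ⟨-, rfl⟩
        · exact hv
        · exact hu
      exact ih hb ⟨c, hcB, SimpleGraph.Reachable.refl _⟩
    · have hadj' : (Literature.Probability.Percolation.openGraph (ω \ {s(u, v)})).Adj a c := by
        rw [Literature.Probability.Percolation.openGraph_adj] at hadj ⊢
        exact ⟨⟨hadj.1, hc⟩, hadj.2⟩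
      exact ih hb ⟨x, hx, hxa.trans hadj'.reachable⟩

/-- **Closing an edge inside the second arc keeps the crossing** (symmetric form). [folklore] -/
theorem zeroFreeNonCrossing_sdiff_mem_arcCrossing' {V : Type*} {B₁ B₂ : Set V}
    {ω : Literature.Probability.Percolation.BondConfig V} {u v : V} (hu : u ∈ B₂) (hv : v ∈ B₂)
    (h : ω ∈ arcCrossing B₁ B₂) : ω \ {s(u, v)} ∈ arcCrossing B₁ B₂ :=
  zeroFreeNonCrossing_mem_arcCrossing_comm.1
    (zeroFreeNonCrossing_sdiff_mem_arcCrossing hu hv (zeroFreeNonCrossing_mem_arcCrossing_comm.1 h))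

/-- **Toggle-invariance of the crossing event.** For an edge `uv` with both endpoints in one of
the two arcs and a finite configuration `ω ∌ uv`: `ω ∪ {uv}` crosses iff `ω` crosses (the event
is increasing, and a crossing never needs an edge inside a wired arc). [folklore] -/
theorem zeroFreeNonCrossing_insert_mem_arcCrossing_iff {V : Type*} [DecidableEq V] {B₁ B₂ : Set V}
    {u v : V} (huv : u ∈ B₁ ∧ v ∈ B₁ ∨ u ∈ B₂ ∧ v ∈ B₂) {ω : Finset (Sym2 V)}
    (hω : s(u, v) ∉ ω) :
    ((↑(insert s(u, v) ω) : Literature.Probability.Percolation.BondConfig V) ∈ arcCrossing B₁ B₂ ↔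
      (↑ω : Literature.Probability.Percolation.BondConfig V) ∈ arcCrossing B₁ B₂) := by
  refine ⟨fun h => ?_, fun h => isUpperSet_arcCrossing B₁ B₂ (by simp) h⟩
  have e : ((↑(insert s(u, v) ω) : Set (Sym2 V)) \ {s(u, v)}) = ↑ω := by
    rw [Finset.coe_insert, Set.insert_sdiff_self_of_notMem (by exact_mod_cast hω)]
  rw [← e]
  rcases huv with ⟨hu, hv⟩ | ⟨hu, hv⟩
  · exact zeroFreeNonCrossing_sdiff_mem_arcCrossing hu hv h
  · exact zeroFreeNonCrossing_sdiff_mem_arcCrossing' hu hv h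

/-! ### (P4) Consequences for `N_δ` and `N^c_δ = Z_δ − N_δ`, given an edge inside a discrete arc -/

/-- **`N_δ(−1) = 0` given an edge of `Ω_δ` inside a discrete arc.** For `δ > 0`, if some edge of
`Ω_δ = domainSubgraph R.carrier δ` has both endpoints in the discrete arc of `(ab)` (or both in
that of `(cd)`), then the crossing polynomial vanishes at `t = −1`, for either wiring. [folklore] -/
theorem zeroFreeNonCrossing_aeval_neg_one_crossing_of_adj (R : ConformalRectangle) {δ : ℝ}
    (hδ : 0 < δ) {x y : meshDomain R.carrier δ} (hxy : (domainSubgraph R.carrier δ).Adj x y)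
    (hA : x ∈ rectArc R δ 0 ∧ y ∈ rectArc R δ 0 ∨ x ∈ rectArc R δ 2 ∧ y ∈ rectArc R δ 2)
    (w : ArcWiring) : aeval (-1 : ℂ) (fkTwoArcCrossingPolynomial R δ w) = 0 := by
  classical
  letI : Fintype (meshDomain R.carrier δ) := (meshDomain_finite R.isBounded hδ).fintype
  rw [fkTwoArcCrossingPolynomial_eq_rcArcPolynomialIn R hδ]
  refine zeroFreeNonCrossing_aeval_neg_one_rcArcPolynomialIn _ _ _ _ _ (e := s(x, y))
    (SimpleGraph.mem_edgeFinset.2 ((SimpleGraph.mem_edgeSet _).2 hxy)) fun ω _ hω => ?_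
  exact zeroFreeNonCrossing_insert_mem_arcCrossing_iff hA hω

/-- **`N^c_δ(−1) = 0` given an edge inside a discrete arc**: under the same hypothesis
`N_δ(−1) = Z_δ(−1)` (both vanish, `Z_δ(−1) = 0` by `zeroFreeJoint_aeval_neg_one_rcArcPolynomial`),
i.e. the non-crossing polynomial `N^c_δ = Z_δ − N_δ` vanishes at `t = −1`. [folklore] -/
theorem zeroFreeNonCrossing_aeval_neg_one_eq_of_adj (R : ConformalRectangle) {δ : ℝ} (hδ : 0 < δ)
    {x y : meshDomain R.carrier δ} (hxy : (domainSubgraph R.carrier δ).Adj x y)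
    (hA : x ∈ rectArc R δ 0 ∧ y ∈ rectArc R δ 0 ∨ x ∈ rectArc R δ 2 ∧ y ∈ rectArc R δ 2)
    (w : ArcWiring) :
    aeval (-1 : ℂ) (fkTwoArcCrossingPolynomial R δ w) =
      aeval (-1 : ℂ) (fkTwoArcPartitionPolynomials R δ w) := by
  classical
  letI : Fintype (meshDomain R.carrier δ) := (meshDomain_finite R.isBounded hδ).fintype
  rw [zeroFreeNonCrossing_aeval_neg_one_crossing_of_adj R hδ hxy hA,
    fkTwoArcPartitionPolynomials_of_pos R hδ, zeroFreeJoint_aeval_neg_one_rcArcPolynomial _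
      ⟨s(x, y), SimpleGraph.mem_edgeFinset.2 ((SimpleGraph.mem_edgeSet _).2 hxy)⟩]

/-- `t = −1` lies in the complex `ρ`-neighbourhood of `[t₁, 1]` as soon as `ρ > 1 + t₁`
(`0 < t₁ ≤ 1`). [folklore] -/
theorem zeroFreeNonCrossing_neg_one_mem_thickening {t₁ ρ : ℝ} (ht₀ : 0 < t₁) (ht₁ : t₁ ≤ 1)
    (hlt : 1 + t₁ < ρ) : (-1 : ℂ) ∈ thickening ρ (((↑) : ℝ → ℂ) '' Set.Icc t₁ 1) := by
  refine mem_thickening_iff.2 ⟨t₁, ⟨t₁, ⟨le_rfl, ht₁⟩, rfl⟩, ?_⟩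
  rw [Complex.dist_eq, show (-1 : ℂ) - (t₁ : ℂ) = -((1 + t₁ : ℝ) : ℂ) by push_cast; ring, norm_neg,
    Complex.norm_real, Real.norm_eq_abs, abs_of_pos (by linarith)]
  exact hlt

/-- **Tightness of `stub_zeroFreeCrossing` at `t = −1`, given edges inside a discrete arc.** If
for arbitrarily small `δ > 0` the discrete domain `Ω_δ` has an edge with both endpoints in one
discrete arc, then every witness `ρ` of the conclusion of `stub_zeroFreeCrossing` at `(R, t₁)`,
`0 < t₁ ≤ 1`, satisfies `ρ ≤ 1 + t₁` (otherwise the neighbourhood contains the zero `t = −1` of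
`N_δ`). [folklore] -/
theorem zeroFreeNonCrossing_crossing_rho_le_of_frequently_adj (R : ConformalRectangle) {t₁ ρ : ℝ}
    (ht₀ : 0 < t₁) (ht₁ : t₁ ≤ 1)
    (hadj : ∃ᶠ δ in 𝓝[>] (0:ℝ), ∃ x y : meshDomain R.carrier δ,
      (domainSubgraph R.carrier δ).Adj x y ∧
        (x ∈ rectArc R δ 0 ∧ y ∈ rectArc R δ 0 ∨ x ∈ rectArc R δ 2 ∧ y ∈ rectArc R δ 2))
    (h : ∀ᶠ δ in 𝓝[>] (0:ℝ), ∀ z ∈ thickening ρ (((↑) : ℝ → ℂ) '' Set.Icc t₁ 1),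
      aeval z (fkTwoArcCrossingPolynomial R δ ArcWiring.joint) ≠ 0) :
    ρ ≤ 1 + t₁ := by
  refine le_of_not_gt fun hlt => ?_
  have hmem := zeroFreeNonCrossing_neg_one_mem_thickening ht₀ ht₁ hlt
  obtain ⟨δ, ⟨hδz, hδ⟩, x, y, hxy, hA⟩ :=
    ((h.and self_mem_nhdsWithin).and_frequently hadj).exists
  exact hδz _ hmem (zeroFreeNonCrossing_aeval_neg_one_crossing_of_adj R hδ hxy hA _)

/-- **Tightness of `stub_zeroFreeNonCrossing` at `t = −1`, given edges inside a discrete arc.**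
If for arbitrarily small `δ > 0` the discrete domain `Ω_δ` has an edge with both endpoints in one
discrete arc, then every witness `ρ` of the conclusion of `stub_zeroFreeNonCrossing` at `(R, t₁)`,
`0 < t₁ ≤ 1`, satisfies `ρ ≤ 1 + t₁` (otherwise the neighbourhood contains `t = −1`, where
`N_δ = Z_δ`). [folklore] -/
theorem zeroFreeNonCrossing_rho_le_of_frequently_adj (R : ConformalRectangle) {t₁ ρ : ℝ}
    (ht₀ : 0 < t₁) (ht₁ : t₁ ≤ 1)
    (hadj : ∃ᶠ δ in 𝓝[>] (0:ℝ), ∃ x y : meshDomain R.carrier δ,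
      (domainSubgraph R.carrier δ).Adj x y ∧
        (x ∈ rectArc R δ 0 ∧ y ∈ rectArc R δ 0 ∨ x ∈ rectArc R δ 2 ∧ y ∈ rectArc R δ 2))
    (h : ∀ᶠ δ in 𝓝[>] (0:ℝ), ∀ z ∈ thickening ρ (((↑) : ℝ → ℂ) '' Set.Icc t₁ 1),
      aeval z (fkTwoArcCrossingPolynomial R δ ArcWiring.joint) ≠
        aeval z (fkTwoArcPartitionPolynomials R δ ArcWiring.joint)) :
    ρ ≤ 1 + t₁ := by
  refine le_of_not_gt fun hlt => ?_
  have hmem := zeroFreeNonCrossing_neg_one_mem_thickening ht₀ ht₁ hlt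
  obtain ⟨δ, ⟨hδz, hδ⟩, x, y, hxy, hA⟩ :=
    ((h.and self_mem_nhdsWithin).and_frequently hadj).exists
  exact hδz _ hmem (zeroFreeNonCrossing_aeval_neg_one_eq_of_adj R hδ hxy hA _)

/-- **Registered sub-goal (tightness of `stub_zeroFreeNonCrossing` at `t = −1`).** For every
conformal rectangle `R`, `t₁ ∈ (0,1)` and `ρ`: if for arbitrarily small `δ > 0` the discrete domain
`Ω_δ` has an edge with both endpoints in one discrete arc (true for all small `δ` for axis-parallel
rectangles, companion file; false for the diamond), and `N_δ(z) ≠ Z_δ(z)` on the complex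
`ρ`-neighbourhood of `[t₁, 1]` for all small `δ` (the conclusion of the stub with witness `ρ`), then
`ρ ≤ 1 + t₁`. [folklore] -/
theorem zeroFreeNonCrossing_rho_le :
    ∀ R : ConformalRectangle, ∀ t₁ ∈ Set.Ioo (0:ℝ) 1, ∀ ρ : ℝ,
      (∃ᶠ δ in 𝓝[>] (0:ℝ), ∃ x y : meshDomain R.carrier δ, (domainSubgraph R.carrier δ).Adj x y ∧
        (x ∈ rectArc R δ 0 ∧ y ∈ rectArc R δ 0 ∨ x ∈ rectArc R δ 2 ∧ y ∈ rectArc R δ 2)) →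
      (∀ᶠ δ in 𝓝[>] (0:ℝ), ∀ z ∈ thickening ρ (((↑) : ℝ → ℂ) '' Set.Icc t₁ 1),
        aeval z (fkTwoArcCrossingPolynomial R δ ArcWiring.joint) ≠
          aeval z (fkTwoArcPartitionPolynomials R δ ArcWiring.joint)) →
      ρ ≤ 1 + t₁ :=
  fun R _ ht₁ _ hadj h => zeroFreeNonCrossing_rho_le_of_frequently_adj R ht₁.1 ht₁.2.le hadj h

/-! ### (P5) The pencil of the two wirings -/

/-- **Pencil identities.** For `δ > 0` with nonempty discrete arcs, at every `z ∈ ℂ`: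
`(z² − 1)·N_δ(z) = z²·Z^joint_δ(z) − Z^sep_δ(z)` and
`(z² − 1)·(Z^joint_δ(z) − N_δ(z)) = Z^sep_δ(z) − Z^joint_δ(z)` — the evaluations at `z` of the
polynomial identity `Z^sep + X²·N = N + X²·Z^joint` (`fkTwoArcPartitionPolynomials_separate_add`):
`N_δ` and `N^c_δ = Z^joint_δ − N_δ` are, up to the factor `z² − 1`, the two canonical members
`z²·Z^joint − Z^sep`, `Z^sep − Z^joint` of the pencil spanned by the two wirings' partition
functions. [folklore] -/
theorem zeroFreeNonCrossing_pencil (R : ConformalRectangle) {δ : ℝ} (hδ : 0 < δ)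
    (h0 : (discreteArc R.carrier δ (R.arc 0)).Nonempty)
    (h2 : (discreteArc R.carrier δ (R.arc 2)).Nonempty) (z : ℂ) :
    (z ^ 2 - 1) * aeval z (fkTwoArcCrossingPolynomial R δ ArcWiring.joint) =
        z ^ 2 * aeval z (fkTwoArcPartitionPolynomials R δ ArcWiring.joint) -
          aeval z (fkTwoArcPartitionPolynomials R δ ArcWiring.separate) ∧
      (z ^ 2 - 1) * (aeval z (fkTwoArcPartitionPolynomials R δ ArcWiring.joint) -
          aeval z (fkTwoArcCrossingPolynomial R δ ArcWiring.joint)) =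
        aeval z (fkTwoArcPartitionPolynomials R δ ArcWiring.separate) -
          aeval z (fkTwoArcPartitionPolynomials R δ ArcWiring.joint) := by
  have h := congrArg (aeval z) (fkTwoArcPartitionPolynomials_separate_add R hδ h0 h2)
  simp only [map_add, map_mul, map_pow, aeval_X] at h
  exact ⟨by linear_combination h, by linear_combination -h⟩

/-- **Zero-freeness read in the pencil.** For `δ > 0` with nonempty discrete arcs and `z² ≠ 1`:
`N_δ(z) ≠ Z^joint_δ(z) ↔ Z^sep_δ(z) ≠ Z^joint_δ(z)` (the conclusion of `stub_zeroFreeNonCrossing`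
at `z`) and `N_δ(z) ≠ 0 ↔ z²·Z^joint_δ(z) ≠ Z^sep_δ(z)` (that of `stub_zeroFreeCrossing`).
[folklore] -/
theorem zeroFreeNonCrossing_ne_iff_of_sq_ne_one (R : ConformalRectangle) {δ : ℝ} (hδ : 0 < δ)
    (h0 : (discreteArc R.carrier δ (R.arc 0)).Nonempty)
    (h2 : (discreteArc R.carrier δ (R.arc 2)).Nonempty) {z : ℂ} (hz : z ^ 2 ≠ 1) :
    (aeval z (fkTwoArcCrossingPolynomial R δ ArcWiring.joint) ≠
          aeval z (fkTwoArcPartitionPolynomials R δ ArcWiring.joint) ↔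
        aeval z (fkTwoArcPartitionPolynomials R δ ArcWiring.separate) ≠
          aeval z (fkTwoArcPartitionPolynomials R δ ArcWiring.joint)) ∧
      (aeval z (fkTwoArcCrossingPolynomial R δ ArcWiring.joint) ≠ 0 ↔
        z ^ 2 * aeval z (fkTwoArcPartitionPolynomials R δ ArcWiring.joint) ≠
          aeval z (fkTwoArcPartitionPolynomials R δ ArcWiring.separate)) := by
  obtain ⟨hN, hC⟩ := zeroFreeNonCrossing_pencil R hδ h0 h2 z
  have hz' : z ^ 2 - 1 ≠ 0 := sub_ne_zero.2 hz
  refine ⟨⟨fun hne heq => hne ?_, fun hne heq => hne ?_⟩,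
    ⟨fun hne heq => hne ?_, fun hne heq => hne ?_⟩⟩
  · rw [heq, sub_self] at hC
    exact (sub_eq_zero.1 ((mul_eq_zero.1 hC).resolve_left hz')).symm
  · rw [heq, sub_self, mul_zero] at hC
    exact sub_eq_zero.1 hC.symm
  · rw [heq, sub_self] at hN
    exact (mul_eq_zero.1 hN).resolve_left hz'
  · rw [heq, mul_zero] at hN
    exact sub_eq_zero.1 hN.symm

/-- The discrete arcs of `(ab)` and `(cd)` are eventually nonempty (they are eventually joined by
a path of `Ω_δ`, `zeroFreeCrossing_eventually_reachable`). [folklore] -/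
theorem zeroFreeNonCrossing_eventually_discreteArc_nonempty (R : ConformalRectangle) :
    ∀ᶠ δ in 𝓝[>] (0:ℝ), (discreteArc R.carrier δ (R.arc 0)).Nonempty ∧
      (discreteArc R.carrier δ (R.arc 2)).Nonempty := by
  filter_upwards [zeroFreeCrossing_eventually_reachable R] with δ ⟨a, ha, z, hz, _⟩
  exact ⟨⟨a, ha⟩, ⟨z, hz⟩⟩

/-- **Pencil identities, eventually in `δ`.** For every conformal rectangle, for all small `δ > 0`
and every `z ∈ ℂ`: `(z² − 1)·N_δ(z) = z²·Z^joint_δ(z) − Z^sep_δ(z)` and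
`(z² − 1)·(Z^joint_δ(z) − N_δ(z)) = Z^sep_δ(z) − Z^joint_δ(z)`; hence for `z² ≠ 1` the two
sibling stubs `stub_zeroFreeNonCrossing` / `stub_zeroFreeCrossing` at `z` read
`Z^sep_δ(z) ≠ Z^joint_δ(z)` / `z²·Z^joint_δ(z) ≠ Z^sep_δ(z)`. [folklore] -/
theorem zeroFreeNonCrossing_eventually_pencil (R : ConformalRectangle) :
    ∀ᶠ δ in 𝓝[>] (0:ℝ), ∀ z : ℂ,
      ((z ^ 2 - 1) * aeval z (fkTwoArcCrossingPolynomial R δ ArcWiring.joint) =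
          z ^ 2 * aeval z (fkTwoArcPartitionPolynomials R δ ArcWiring.joint) -
            aeval z (fkTwoArcPartitionPolynomials R δ ArcWiring.separate) ∧
        (z ^ 2 - 1) * (aeval z (fkTwoArcPartitionPolynomials R δ ArcWiring.joint) -
            aeval z (fkTwoArcCrossingPolynomial R δ ArcWiring.joint)) =
          aeval z (fkTwoArcPartitionPolynomials R δ ArcWiring.separate) -
            aeval z (fkTwoArcPartitionPolynomials R δ ArcWiring.joint)) ∧
      (z ^ 2 ≠ 1 →
        (aeval z (fkTwoArcCrossingPolynomial R δ ArcWiring.joint) ≠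
              aeval z (fkTwoArcPartitionPolynomials R δ ArcWiring.joint) ↔
            aeval z (fkTwoArcPartitionPolynomials R δ ArcWiring.separate) ≠
              aeval z (fkTwoArcPartitionPolynomials R δ ArcWiring.joint)) ∧
          (aeval z (fkTwoArcCrossingPolynomial R δ ArcWiring.joint) ≠ 0 ↔
            z ^ 2 * aeval z (fkTwoArcPartitionPolynomials R δ ArcWiring.joint) ≠
              aeval z (fkTwoArcPartitionPolynomials R δ ArcWiring.separate))) := by
  filter_upwards [zeroFreeNonCrossing_eventually_discreteArc_nonempty R, self_mem_nhdsWithin]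
    with δ hne hδ z
  exact ⟨zeroFreeNonCrossing_pencil R hδ hne.1 hne.2 z,
    fun hz => zeroFreeNonCrossing_ne_iff_of_sq_ne_one R hδ hne.1 hne.2 hz⟩

end Summit.CriticalPhenomena.CardyFormulaZ2.Cruxes.UniformAnalyticExtension.Birth
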